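import Summits.KontsevichZagierPeriods.KontsevichZagierPeriods.Theses.DefinableMoves
import Summits.KontsevichZagierPeriods.KontsevichZagierPeriods.Theorems.DefinableMovesCovTransferParam
import Summits.KontsevichZagierPeriods.KontsevichZagierPeriods.Theorems.DefinableMovesCovTransferDeriv
import Summits.KontsevichZagierPeriods.KontsevichZagierPeriods.Theorems.DefinableMovesCovTransferDefKit
import Summits.KontsevichZagierPeriods.KontsevichZagierPeriods.Theorems.DefinableMovesCovTransferClauses
import HarnessLib

/-!
# KontsevichZagierPeriods / DefinableMoves — `CovTransfer` (item stmt-KontsevichZagierPeriods-4093)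

Settles the support item `CovTransfer` of route `DefinableMoves`: a change of variables along an
`ℝ`-semialgebraic map `Φ` (real parameters allowed) between two `ℚ`-representations `r`, `r'`,
with the exact side conditions of `KZ.changeOfVariablesRel` (derivative `Φ'` within the domain,
injectivity, `r'.domain = Φ '' r.domain`, Jacobian identity), is already a KZ-equivalence.

Proof (Tarski-transfer bookkeeping, no integrability input): the graph of `Φ` over `σ = r.domain`
is the fibre `G_{d₀}` of a `ℚ`-semialgebraic family `W` (`exists_family_graph`, from
`exists_rat_family`); the set `T ⊆ ℝ^q` of coefficient vectors `d` for which `G_d` is the graph of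
an injective map of `σ` onto `σ' = r'.domain` with a derivative matrix at every point of `σ`
(little-`o` in the sup metric, `hasFDerivWithinAt_iff_coord`) satisfying the Jacobian identity
(the values of the two integrands read off their `ℚ`-semialgebraic graphs) is `ℚ`-definable
(`definable_clause₁`–`definable_clause₆`), hence `ℚ`-semialgebraic
(`isSemialgebraic_of_definable`, Tarski–Seidenberg), and contains `d₀`; by definable choice it
contains a point `d₁` with `{d₁}` `ℚ`-semialgebraic (`exists_mem_isSemialgebraic_singleton`); the
map `Φ₁` with graph `G_{d₁}` is then `ℚ`-semialgebraic on `σ` and satisfies every side condition of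
the move, so `[r] − [r'] ∈ KZ.changeOfVariablesRel ⊆ KZ.relations` (`equivalent_of_clauses`).

References: Kontsevich–Zagier 2001, §1.2 rule (2); Basu–Pollack–Roy 2006, §2.5 (Tarski–Seidenberg,
transfer); van den Dries 1998, Ch. 6 (1.2)(i) (definable choice).
-/

noncomputable section

open Set FirstOrder FirstOrder.Language MvPolynomial

namespace Summit.KontsevichZagierPeriods.DefinableMoves

namespace CovTransferAux

open Literature.ModelTheory.ExponentialFields Literature.NumberTheory.Transcendental

/-- **The graph of a real-semialgebraic map is a fibre of a rational family.** If `Φ` is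
`ℝ`-semialgebraic on `σ ⊆ ℝⁿ` there are `q`, a `ℚ`-semialgebraic `W ⊆ ℝ^((n ⊕ n) ⊕ q)` and
`d₀ ∈ ℝ^q` with `((x, y), d₀) ∈ W ↔ x ∈ σ ∧ y = Φ x`. [folklore] -/
theorem exists_family_graph {n : ℕ} {σ : Set (Fin n → ℝ)} {Φ : (Fin n → ℝ) → (Fin n → ℝ)}
    (hΦ : IsSemialgebraicMapOn ℝ σ Φ) :
    ∃ (q : ℕ) (W : Set ((Fin n ⊕ Fin n) ⊕ Fin q → ℝ)) (d₀ : Fin q → ℝ), IsSemialgebraic ℚ W ∧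
      ∀ x y : Fin n → ℝ, Sum.elim (Sum.elim x y) d₀ ∈ W ↔ x ∈ σ ∧ y = Φ x := by
  have hG := (show IsSemialgebraic ℝ {z : Fin (n + n) → ℝ | ∃ x ∈ σ, z = Fin.append x (Φ x)}
    from hΦ).preimage_comp (finSumFinEquiv (m := n) (n := n)).symm
  obtain ⟨q, W, d₀, hW, hmem⟩ := exists_rat_family hG
  refine ⟨q, W, d₀, hW, fun x y => ?_⟩
  rw [← hmem]
  simp only [mem_preimage, mem_setOf_eq]
  have key : ∀ x' y' : Fin n → ℝ,
      (Sum.elim x y ∘ ⇑(finSumFinEquiv (m := n) (n := n)).symm = Fin.append x' y') ↔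
        x = x' ∧ y = y' := by
    intro x' y'
    constructor
    · intro h
      constructor
      · funext i
        have := congrFun h (Fin.castAdd n i)
        simpa only [Function.comp_apply, finSumFinEquiv_symm_apply_castAdd, Sum.elim_inl,
          Fin.append_left] using this
      · funext j
        have := congrFun h (Fin.natAdd n j)
        simpa only [Function.comp_apply, finSumFinEquiv_symm_apply_natAdd, Sum.elim_inr,
          Fin.append_right] using this
    · rintro ⟨rfl, rfl⟩
      funext k
      refine Fin.addCases (fun i => ?_) (fun j => ?_) k
      · simp only [Function.comp_apply, finSumFinEquiv_symm_apply_castAdd, Sum.elim_inl,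
          Fin.append_left]
      · simp only [Function.comp_apply, finSumFinEquiv_symm_apply_natAdd, Sum.elim_inr,
          Fin.append_right]
  constructor
  · rintro ⟨x', hx', h⟩
    obtain ⟨rfl, rfl⟩ := (key x' _).1 h
    exact ⟨hx', rfl⟩
  · rintro ⟨hx, rfl⟩
    exact ⟨x, hx, (key x (Φ x)).2 ⟨rfl, rfl⟩⟩

/-- Membership of `(x, a)` in the graph of `f` over `s`. [folklore] -/
theorem snoc_mem_graph_iff {n : ℕ} {s : Set (Fin n → ℝ)} {f : (Fin n → ℝ) → ℝ}
    {x : Fin n → ℝ} {a : ℝ} :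
    (Fin.snoc x a : Fin (n + 1) → ℝ) ∈ {z : Fin (n + 1) → ℝ | ∃ x ∈ s, z = Fin.snoc x (f x)} ↔
      x ∈ s ∧ a = f x := by
  rw [setOf_exists_eq_snoc]
  simp only [mem_setOf_eq, Fin.init_snoc, Fin.snoc_last]

/-- **Extraction.** If, for a coefficient vector `d₁` with `{d₁}` `ℚ`-semialgebraic, the fibre
`G_{d₁}` of the `ℚ`-semialgebraic family `W` satisfies the six validity clauses with respect to
the representations `r`, `r'` (graph over `r.domain` of an injective map onto `r'.domain`, with a
derivative matrix within `r.domain` at each of its points satisfying the Jacobian identity between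
the two integrands), then the map `Φ₁` with graph `G_{d₁}` is a `ℚ`-semialgebraic change of
variables carrying `r` to `r'`, so `r` and `r'` are KZ-equivalent
(`KZ.changeOfVariablesRel ⊆ KZ.relations`). [cite: KontsevichZagier2001, §1.2 rule (2)] -/
theorem equivalent_of_clauses {n q : ℕ} (r r' : KZ.IntegralRep n)
    (W : Set ((Fin n ⊕ Fin n) ⊕ Fin q → ℝ)) (d₁ : Fin q → ℝ) (hW : IsSemialgebraic ℚ W)
    (hd₁ : IsSemialgebraic ℚ ({d₁} : Set (Fin q → ℝ)))
    (h₁ : ∀ x : Fin n → ℝ, x ∈ r.domain → ∃ y : Fin n → ℝ, Sum.elim (Sum.elim x y) d₁ ∈ W)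
    (h₂ : ∀ x y y' : Fin n → ℝ, x ∈ r.domain → Sum.elim (Sum.elim x y) d₁ ∈ W →
      Sum.elim (Sum.elim x y') d₁ ∈ W → ∀ i, y i = y' i)
    (h₃ : ∀ x x' y : Fin n → ℝ, x ∈ r.domain → x' ∈ r.domain →
      Sum.elim (Sum.elim x y) d₁ ∈ W → Sum.elim (Sum.elim x' y) d₁ ∈ W → ∀ i, x i = x' i)
    (h₄ : ∀ x y : Fin n → ℝ, x ∈ r.domain → Sum.elim (Sum.elim x y) d₁ ∈ W → y ∈ r'.domain)
    (h₅ : ∀ y : Fin n → ℝ, y ∈ r'.domain → ∃ x : Fin n → ℝ, x ∈ r.domain ∧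
      Sum.elim (Sum.elim x y) d₁ ∈ W)
    (h₆ : ∀ x y : Fin n → ℝ, x ∈ r.domain → Sum.elim (Sum.elim x y) d₁ ∈ W →
      ∃ L : Fin n × Fin n → ℝ,
        (∀ c : ℝ, 0 < c → ∃ δ : ℝ, 0 < δ ∧ ∀ x₁ y₁ : Fin n → ℝ, x₁ ∈ r.domain →
          Sum.elim (Sum.elim x₁ y₁) d₁ ∈ W → (∀ i, x₁ i - x i < δ ∧ x i - x₁ i < δ) →
            ∀ i, ∃ j, (y₁ i - y i - ∑ k, L (i, k) * (x₁ k - x k)) ^ 2 ≤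
              c ^ 2 * (x₁ j - x j) ^ 2) ∧
        (∃ ab : Fin 2 → ℝ, (Fin.snoc x (ab 0) : Fin (n + 1) → ℝ) ∈
            {z : Fin (n + 1) → ℝ | ∃ x ∈ r.domain, z = Fin.snoc x (r.integrand x)} ∧
          (Fin.snoc y (ab 1) : Fin (n + 1) → ℝ) ∈
            {z : Fin (n + 1) → ℝ | ∃ x ∈ r'.domain, z = Fin.snoc x (r'.integrand x)} ∧
          ((0 ≤ (Matrix.of fun i j => L (i, j)).det ∧
              ab 0 = ab 1 * (Matrix.of fun i j => L (i, j)).det) ∨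
            ((Matrix.of fun i j => L (i, j)).det ≤ 0 ∧
              ab 0 = -(ab 1 * (Matrix.of fun i j => L (i, j)).det))))) :
    KZ.Equivalent r r' := by
  classical
  -- the map `Φ₁` with graph `G_{d₁}` over `σ = r.domain`, and uniqueness
  choose! Φ₁ hΦ₁ using h₁
  have huniq : ∀ x ∈ r.domain, ∀ y, Sum.elim (Sum.elim x y) d₁ ∈ W → y = Φ₁ x :=
    fun x hx y hy => funext (h₂ x y (Φ₁ x) hx hy (hΦ₁ x hx))
  -- the derivative matrices
  have h₆' : ∀ x ∈ r.domain, ∃ L : Fin n × Fin n → ℝ,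
      (∀ c : ℝ, 0 < c → ∃ δ : ℝ, 0 < δ ∧ ∀ x₁ y₁ : Fin n → ℝ, x₁ ∈ r.domain →
        Sum.elim (Sum.elim x₁ y₁) d₁ ∈ W → (∀ i, x₁ i - x i < δ ∧ x i - x₁ i < δ) →
          ∀ i, ∃ j, (y₁ i - Φ₁ x i - ∑ k, L (i, k) * (x₁ k - x k)) ^ 2 ≤
            c ^ 2 * (x₁ j - x j) ^ 2) ∧
      (∃ ab : Fin 2 → ℝ, (Fin.snoc x (ab 0) : Fin (n + 1) → ℝ) ∈
          {z : Fin (n + 1) → ℝ | ∃ x ∈ r.domain, z = Fin.snoc x (r.integrand x)} ∧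
        (Fin.snoc (Φ₁ x) (ab 1) : Fin (n + 1) → ℝ) ∈
          {z : Fin (n + 1) → ℝ | ∃ x ∈ r'.domain, z = Fin.snoc x (r'.integrand x)} ∧
        ((0 ≤ (Matrix.of fun i j => L (i, j)).det ∧
            ab 0 = ab 1 * (Matrix.of fun i j => L (i, j)).det) ∨
          ((Matrix.of fun i j => L (i, j)).det ≤ 0 ∧
            ab 0 = -(ab 1 * (Matrix.of fun i j => L (i, j)).det)))) :=
    fun x hx => h₆ x (Φ₁ x) hx (hΦ₁ x hx)
  choose! Lm hLm using h₆'
  set Φ₁' : (Fin n → ℝ) → (Fin n → ℝ) →L[ℝ] (Fin n → ℝ) := fun x =>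
    LinearMap.toContinuousLinearMap (Matrix.toLin' (Matrix.of fun i j => Lm x (i, j))) with hΦ₁'
  refine KZ.changeOfVariablesRel_subset_relations ⟨n, r, r', Φ₁, Φ₁', ?_, ?_, ?_, ?_, ?_, rfl⟩
  · -- `Φ₁` is `ℚ`-semialgebraic on `σ`: its graph is `{z | ∃ d ∈ {d₁}, z_x ∈ σ ∧ (z, d) ∈ W}`
    have hσd := definable_of_isSemialgebraic' r.isSemialgebraic_domain
    have hWd := definable_of_isSemialgebraic' hW
    have hd₁d := definable_of_isSemialgebraic' hd₁
    have hdef : Set.Definable (Set.range ((↑) : ℚ → ℝ)) Language.orderedRing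
        {z : Fin (n + n) → ℝ | ∃ d : Fin q → ℝ, (fun l => d l) ∈ ({d₁} : Set (Fin q → ℝ)) ∧
          (fun i => z (Fin.castAdd n i)) ∈ r.domain ∧
          Sum.elim (Sum.elim (fun i => z (Fin.castAdd n i)) (fun j => z (Fin.natAdd n j)))
            (fun l => d l) ∈ W} := by
      apply definable_exists_block (β := Fin q)
      exact definable_setOf_and_params (definable_memTuple hd₁d _)
        (definable_setOf_and_params (definable_memTuple hσd _) (definable_memSum hWd _ _ _))
    refine (isSemialgebraic_of_definable hdef).of_forall_iff_mem fun z => ?_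
    simp only [mem_setOf_eq, mem_singleton_iff]
    constructor
    · rintro ⟨x, hx, rfl⟩
      have e1 : (fun i => Fin.append x (Φ₁ x) (Fin.castAdd n i)) = x :=
        funext fun i => Fin.append_left _ _ _
      have e2 : (fun j => Fin.append x (Φ₁ x) (Fin.natAdd n j)) = Φ₁ x :=
        funext fun j => Fin.append_right _ _ _
      refine ⟨d₁, rfl, ?_, ?_⟩
      · rw [e1]
        exact hx
      · rw [e1, e2]
        exact hΦ₁ x hx
    · rintro ⟨d, hd, hz, hzW⟩
      have hd' : d = d₁ := hd
      subst hd'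
      refine ⟨fun i => z (Fin.castAdd n i), hz, ?_⟩
      rw [← huniq _ hz _ hzW, Fin.append_castAdd_natAdd]
  · -- derivative within `σ`
    intro x hx
    rw [hasFDerivWithinAt_iff_coord]
    intro c hc
    obtain ⟨δ, hδ, H⟩ := (hLm x hx).1 c hc
    refine ⟨δ, hδ, fun x₁ hx₁ hbox i => ?_⟩
    obtain ⟨j, hj⟩ := H x₁ (Φ₁ x₁) hx₁ (hΦ₁ x₁ hx₁) (fun i => abs_sub_lt_iff.1 (hbox i)) i
    refine ⟨j, ?_⟩
    rw [abs_le_mul_abs_iff_sq hc.le]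
    convert hj using 2
    simp only [hΦ₁', Pi.sub_apply, toContinuousLinearMap_toLin'_apply, Matrix.of_apply]
  · -- injectivity on `σ`
    intro x hx x' hx' heq
    exact funext (h₃ x x' (Φ₁ x) hx hx' (hΦ₁ x hx) (heq ▸ hΦ₁ x' hx'))
  · -- `σ' = Φ₁ '' σ`
    ext y
    constructor
    · intro hy
      obtain ⟨x, hx, hxy⟩ := h₅ y hy
      exact ⟨x, hx, (huniq x hx y hxy).symm⟩
    · rintro ⟨x, hx, rfl⟩
      exact h₄ x (Φ₁ x) hx (hΦ₁ x hx)
  · -- Jacobian identity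
    intro x hx
    obtain ⟨ab, ha, hb, hdet⟩ := (hLm x hx).2
    rw [snoc_mem_graph_iff] at ha hb
    have hD : (Φ₁' x).det = (Matrix.of fun i j => Lm x (i, j)).det := by
      simp only [hΦ₁', toContinuousLinearMap_toLin'_det]
    rw [hD, ← ha.2, ← hb.2]
    rcases hdet with ⟨h0, h⟩ | ⟨h0, h⟩
    · rw [abs_of_nonneg h0]
      exact h
    · rw [abs_of_nonpos h0, mul_neg]
      exact h

end CovTransferAux

open Literature.ModelTheory.ExponentialFields Literature.NumberTheory.Transcendental
  CovTransferAux

/-- **Item stmt-KontsevichZagierPeriods-4093 (`CovTransfer`), settled.** A change of variables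
along an `ℝ`-semialgebraic map `Φ` between two `ℚ`-representations `r`, `r'`, with the exact side
conditions of `KZ.changeOfVariablesRel` (derivative `Φ' x` within `r.domain` at every point,
injectivity on `r.domain`, `r'.domain = Φ '' r.domain`,
`r.integrand x = r'.integrand (Φ x) · |det Φ' x|`), is a KZ-equivalence. Proof: Tarski transfer —
the graph of `Φ` is the fibre at a real coefficient vector `d₀` of a `ℚ`-semialgebraic family
(`exists_family_graph`); validity of a fibre as a change of variables between `r` and `r'` is a
first-order condition over `(ℝ, +, ·, ≤)` with rational parameters (`definable_clause₁`–`₆`,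
with `hasFDerivWithinAt_iff_coord` for the derivative), so the valid coefficient vectors form a
`ℚ`-semialgebraic set (`isSemialgebraic_of_definable`) containing `d₀`; definable choice gives a
valid `d₁` with `{d₁}` `ℚ`-semialgebraic (`exists_mem_isSemialgebraic_singleton`), whose fibre is a
`ℚ`-semialgebraic change of variables (`equivalent_of_clauses`). No integrability input is used.
[cite: KontsevichZagier2001, §1.2 rule (2)] [cite: BasuPollackRoy2006, §2.5.1] -/
theorem CovTransfer_proof :
    Summit.KontsevichZagierPeriods.KontsevichZagierPeriods.Theses.DefinableMoves.CovTransfer := by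
  intro n r r' Φ Φ' hΦ hderiv hinj hdom hjac
  obtain ⟨q, W, d₀, hW, hmem⟩ := exists_family_graph hΦ
  have hσ := r.isSemialgebraic_domain
  have hσ' := r'.isSemialgebraic_domain
  have hΓ : IsSemialgebraic ℚ
      {z : Fin (n + 1) → ℝ | ∃ x ∈ r.domain, z = Fin.snoc x (r.integrand x)} :=
    r.isSemialgebraicFunOn_integrand
  have hΓ' : IsSemialgebraic ℚ
      {z : Fin (n + 1) → ℝ | ∃ x ∈ r'.domain, z = Fin.snoc x (r'.integrand x)} :=
    r'.isSemialgebraicFunOn_integrand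
  -- the set `T` of valid coefficient vectors is `ℚ`-semialgebraic
  have hT := isSemialgebraic_of_definable
    (definable_setOf_and_params (definable_clause₁ hσ hW)
    (definable_setOf_and_params (definable_clause₂ hσ hW)
    (definable_setOf_and_params (definable_clause₃ hσ hW)
    (definable_setOf_and_params (definable_clause₄ hσ hσ' hW)
    (definable_setOf_and_params (definable_clause₅ hσ hσ' hW)
      (definable_clause₆ hσ hΓ hΓ' hW))))))
  -- `d₀ ∈ T`: the clauses hold for the given change of variables
  have hy : ∀ {x y : Fin n → ℝ}, Sum.elim (Sum.elim x y) d₀ ∈ W → x ∈ r.domain ∧ y = Φ x :=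
    fun h => (hmem _ _).1 h
  -- a valid coefficient vector `d₁` with `{d₁}` `ℚ`-semialgebraic (`d₀ ∈ T` by the hypotheses)
  obtain ⟨d₁, hd₁T, hd₁⟩ := exists_mem_isSemialgebraic_singleton hT (by
    refine ⟨d₀, ?_⟩
    simp only [mem_setOf_eq]
    refine ⟨?c₁, ?c₂, ?c₃, ?c₄, ?c₅, ?c₆⟩
    case c₁ =>
      intro x hx
      exact ⟨Φ x, (hmem x _).2 ⟨hx, rfl⟩⟩
    case c₂ =>
      intro x y y' _ hxy hxy' i
      rw [(hy hxy).2, (hy hxy').2]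
    case c₃ =>
      intro x x' y hx hx' hxy hx'y i
      rw [hinj hx hx' ((hy hxy).2.symm.trans (hy hx'y).2)]
    case c₄ =>
      intro x y hx hxy
      rw [(hy hxy).2, hdom]
      exact mem_image_of_mem Φ hx
    case c₅ =>
      intro y hy'
      rw [hdom] at hy'
      obtain ⟨x, hx, rfl⟩ := hy'
      exact ⟨x, hx, (hmem x _).2 ⟨hx, rfl⟩⟩
    case c₆ =>
      intro x y hx hxy
      obtain ⟨-, rfl⟩ := hy hxy
      set M : Matrix (Fin n) (Fin n) ℝ :=
        LinearMap.toMatrix' ((Φ' x : (Fin n → ℝ) →L[ℝ] (Fin n → ℝ)) : (Fin n → ℝ) →ₗ[ℝ] (Fin n → ℝ))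
        with hM
      refine ⟨fun p => M p.1 p.2, ?_, ?_⟩
      · intro c hc
        obtain ⟨δ, hδ, H⟩ := (hasFDerivWithinAt_iff_coord.1 (hderiv x hx)) c hc
        refine ⟨δ, hδ, fun x₁ y₁ hx₁ hx₁y₁ hbox i => ?_⟩
        obtain ⟨-, rfl⟩ := hy hx₁y₁
        obtain ⟨j, hj⟩ := H x₁ hx₁ (fun i => abs_sub_lt_iff.2 (hbox i)) i
        refine ⟨j, ?_⟩
        rw [← abs_le_mul_abs_iff_sq hc.le]
        convert hj using 2
        simp only [Pi.sub_apply, clm_apply_eq_sum_toMatrix' (Φ' x), hM]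
      · have hxy' : Φ x ∈ r'.domain := by
          rw [hdom]
          exact mem_image_of_mem Φ hx
        refine ⟨![r.integrand x, r'.integrand (Φ x)], ?_, ?_, ?_⟩
        · exact ⟨x, hx, rfl⟩
        · exact ⟨Φ x, hxy', rfl⟩
        · have hof : (Matrix.of fun i j => (fun p : Fin n × Fin n => M p.1 p.2) (i, j)) = M := by
            ext i j
            rfl
          rw [hof]
          have hdet : (Φ' x).det = M.det := clm_det_eq_det_toMatrix' (Φ' x)
          have hj := hjac x hx
          rw [hdet] at hj
          simp only [Matrix.cons_val_zero, Matrix.cons_val_one]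
          rcases le_or_gt 0 M.det with h0 | h0
          · left
            rw [abs_of_nonneg h0] at hj
            exact ⟨h0, hj⟩
          · right
            rw [abs_of_neg h0, mul_neg] at hj
            exact ⟨h0.le, hj⟩)
  -- extraction
  obtain ⟨g₁, g₂, g₃, g₄, g₅, g₆⟩ := hd₁T
  exact equivalent_of_clauses r r' W d₁ hW hd₁ g₁ g₂ g₃ g₄ g₅ g₆

end Summit.KontsevichZagierPeriods.DefinableMoves

end
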